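import Mathlib

/-!
# `LocalWeightedDrop`, line `nc-game-transport`, rung R2 (hyperplane arrangements): coordinate subspaces and ADAPTED INVERTIBLE
# MATRICES (linear algebra only)

[OURS · L1 W4.3 · chain w43, engine crux `LocalWeightedDrop` stmt-ResolutionOfSingularities-8899; strategist res-L1-w43-strat-1's line
`nc-game-transport`, TOT rung R2 «hyperplane arrangements» (spec `L/res-L1-w43-strat-1/TOT-RUNGS-SPEC.md` §R2); res-type-088.]  Folklore
linear algebra in `k^d = (Fin d → k)`, in the shapes the arrangement game (`…NCArrangements`) consumes; nothing here is a statement of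
any manuscript.

* `disjoint_span_of_supports` — families supported on disjoint coordinate sets have trivially-meeting spans.
* `vecMul_inv_eq_repr`, `row_vecMul_inv` — `v ↦ v ᵥ* Q⁻¹` is the coordinate map of the basis formed by the rows of an invertible `Q`.
* `exists_adapted_matrix` — for subspaces `W₁, W₂ ≤ k^d` meeting trivially and a basis of `W₁` indexed by `Fin r`: an invertible `Q` whose
  first `r` rows are that basis, in whose coordinates vectors of `W₁` live on the slots `< r` and vectors of `W₂` on the slots `≥ r`.
* `exists_matrix_of_linearIndependent` — coordinates in which a linearly independent finite family becomes distinct standard basis vectors.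
-/

set_option linter.dupNamespace false -- mandated namespace of this single-conjunct summit

namespace Summit.ResolutionOfSingularities.ResolutionOfSingularities.Theorems

namespace NCArrangement

open Module Submodule Matrix

variable {k : Type} [Field k] {d : ℕ} {ι : Type}

/-- The coordinate subspace of vectors vanishing off a set of slots. -/
def suppSub (k : Type) [Field k] (d : ℕ) (T : Fin d → Prop) : Submodule k (Fin d → k) where
  carrier := {v | ∀ i, ¬ T i → v i = 0}
  add_mem' := fun {v w} hv hw i hi => by rw [Pi.add_apply, hv i hi, hw i hi, add_zero]
  zero_mem' := fun _ _ => rfl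
  smul_mem' := fun r {v} hv i hi => by rw [Pi.smul_apply, hv i hi, smul_zero]

/-- Membership in the coordinate subspace. -/
theorem mem_suppSub {T : Fin d → Prop} {v : Fin d → k} : v ∈ suppSub k d T ↔ ∀ i, ¬ T i → v i = 0 := Iff.rfl

/-- FAMILIES SUPPORTED ON DISJOINT COORDINATE SETS HAVE TRIVIALLY-MEETING SPANS. [folklore] -/
theorem disjoint_span_of_supports {a : ι → Fin d → k} {s t : Finset ι} (T₁ T₂ : Fin d → Prop)
    (h₁ : ∀ j ∈ s, ∀ i, ¬ T₁ i → a j i = 0) (h₂ : ∀ j ∈ t, ∀ i, ¬ T₂ i → a j i = 0) (hT : ∀ i, ¬ (T₁ i ∧ T₂ i)) :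
    Disjoint (span k (a '' (↑s : Set ι))) (span k (a '' (↑t : Set ι))) := by
  have hs : span k (a '' (↑s : Set ι)) ≤ suppSub k d T₁ := Submodule.span_le.mpr (by
    rintro _ ⟨j, hj, rfl⟩; exact h₁ j hj)
  have ht : span k (a '' (↑t : Set ι)) ≤ suppSub k d T₂ := Submodule.span_le.mpr (by
    rintro _ ⟨j, hj, rfl⟩; exact h₂ j hj)
  refine Disjoint.mono hs ht ?_
  rw [disjoint_iff_inf_le]
  intro v hv
  obtain ⟨hv₁, hv₂⟩ := Submodule.mem_inf.mp hv
  rw [Submodule.mem_bot]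
  funext i
  by_cases h : T₁ i
  · exact hv₂ i fun h' => hT i ⟨h, h'⟩
  · exact hv₁ i h

/-- `c ᵥ* Q = Σ cᵢ • Qᵢ` (rows). [folklore] -/
theorem vecMul_eq_sum_smul (c : Fin d → k) (Q : Matrix (Fin d) (Fin d) k) : c ᵥ* Q = ∑ i, c i • Q i := by
  funext j
  rw [Matrix.vecMul, dotProduct, Finset.sum_apply]
  exact Finset.sum_congr rfl fun i _ => by rw [Pi.smul_apply, smul_eq_mul]

/-- An invertible matrix: its rows are linearly independent. -/
theorem isUnit_det_of_linearIndependent_rows {Q : Matrix (Fin d) (Fin d) k} (h : LinearIndependent k (fun i => Q i)) :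
    IsUnit Q.det := by
  rw [← Matrix.isUnit_iff_isUnit_det, ← Matrix.linearIndependent_rows_iff_isUnit]
  exact h

/-- COORDINATES: if the rows of an invertible `Q` form the basis `b`, then `v ᵥ* Q⁻¹` is the coordinate vector of `v`. [folklore] -/
theorem vecMul_inv_eq_repr (b : Module.Basis (Fin d) k (Fin d → k)) {Q : Matrix (Fin d) (Fin d) k} (hQ : ∀ i, Q i = b i)
    (hdet : IsUnit Q.det) (v : Fin d → k) : v ᵥ* Q⁻¹ = ⇑(b.repr v) := by
  have hv : v = (⇑(b.repr v)) ᵥ* Q := by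
    rw [vecMul_eq_sum_smul]
    conv_lhs => rw [← b.sum_repr v]
    exact Finset.sum_congr rfl fun i _ => by rw [hQ i]
  conv_lhs => rw [hv]
  rw [Matrix.vecMul_vecMul, Matrix.mul_nonsing_inv _ hdet, Matrix.vecMul_one]

/-- A row of an invertible matrix has coordinate vector the standard basis vector. [folklore] -/
theorem row_vecMul_inv {Q : Matrix (Fin d) (Fin d) k} (hdet : IsUnit Q.det) (i : Fin d) :
    Q i ᵥ* Q⁻¹ = Pi.single i (1 : k) := by
  have : Q i = Pi.single i (1 : k) ᵥ* Q := by rw [Matrix.single_one_vecMul]; rfl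
  rw [this, Matrix.vecMul_vecMul, Matrix.mul_nonsing_inv _ hdet, Matrix.vecMul_one]

/-- In the coordinates of an invertible `Q` no non-zero vector vanishes. -/
theorem vecMul_inv_ne_zero {Q : Matrix (Fin d) (Fin d) k} (hdet : IsUnit Q.det) {v : Fin d → k} (hv : v ≠ 0) :
    v ᵥ* Q⁻¹ ≠ 0 := by
  intro h
  apply hv
  have hinj := Matrix.vecMul_injective_iff_isUnit.mpr
    ((Matrix.isUnit_iff_isUnit_det _).mpr (Matrix.isUnit_nonsing_inv_det Q hdet))
  exact hinj (show v ᵥ* Q⁻¹ = (0 : Fin d → k) ᵥ* Q⁻¹ by rw [h, Matrix.zero_vecMul])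

/-- **ADAPTED INVERTIBLE MATRIX.**  For subspaces `W₁, W₂ ≤ k^d` meeting trivially and a basis `b₁` of `W₁` indexed by `Fin r` there is an
invertible `Q` whose first `r` rows are `b₁` and such that, in the coordinates `v ↦ v ᵥ* Q⁻¹`, vectors of `W₁` vanish on the slots `≥ r` and
vectors of `W₂` vanish on the slots `< r`. [folklore] -/
theorem exists_adapted_matrix {r : ℕ} (W₁ W₂ : Submodule k (Fin d → k)) (hdisj : Disjoint W₁ W₂)
    (b₁ : Module.Basis (Fin r) k W₁) :
    ∃ (Q : Matrix (Fin d) (Fin d) k) (hr : r ≤ d), IsUnit Q.det ∧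
      (∀ i : Fin r, Q (Fin.castLE hr i) = (b₁ i : Fin d → k)) ∧
      (∀ v ∈ W₁, ∀ i : Fin d, r ≤ i.val → (v ᵥ* Q⁻¹) i = 0) ∧
      (∀ v ∈ W₂, ∀ i : Fin d, i.val < r → (v ᵥ* Q⁻¹) i = 0) := by
  -- a complement of `W₁` containing `W₂`
  obtain ⟨C, hC⟩ := Submodule.exists_isCompl (W₁ ⊔ W₂)
  set W₂' := W₂ ⊔ C with hW₂'
  have hcompl : IsCompl W₁ W₂' := by
    constructor
    · rw [disjoint_iff_inf_le]
      intro x hx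
      obtain ⟨hx₁, hx₂⟩ := Submodule.mem_inf.mp hx
      obtain ⟨y, hy, z, hz, hyz⟩ := Submodule.mem_sup.mp hx₂
      have hzin : z ∈ (W₁ ⊔ W₂) ⊓ C := by
        refine Submodule.mem_inf.mpr ⟨?_, hz⟩
        have hz' : z = x - y := by rw [← hyz]; abel
        rw [hz']
        exact Submodule.sub_mem _ (Submodule.mem_sup_left hx₁) (Submodule.mem_sup_right hy)
      rw [hC.inf_eq_bot, Submodule.mem_bot] at hzin
      rw [hzin, add_zero] at hyz
      subst hyz
      have : y ∈ W₁ ⊓ W₂ := Submodule.mem_inf.mpr ⟨hx₁, hy⟩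
      rwa [hdisj.eq_bot] at this
    · rw [codisjoint_iff, hW₂', ← sup_assoc]
      exact hC.sup_eq_top
  have hW₂le : W₂ ≤ W₂' := le_sup_left
  -- dimensions
  have hr : finrank k W₁ = r := by rw [finrank_eq_card_basis b₁, Fintype.card_fin]
  have hdim : finrank k W₁ + finrank k W₂' = d := by
    rw [Submodule.finrank_add_eq_of_isCompl hcompl, finrank_fin_fun]
  have hrd : r ≤ d := by omega
  have hr' : finrank k W₂' = d - r := by omega
  let b₂ : Module.Basis (Fin (d - r)) k W₂' := finBasisOfFinrankEq k W₂' hr'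
  -- the combined basis of `k^d`, reindexed by `Fin d`
  have hsum : r + (d - r) = d := by omega
  let e : Fin r ⊕ Fin (d - r) ≃ Fin d := finSumFinEquiv.trans (finCongr hsum)
  let bV : Module.Basis (Fin d) k (Fin d → k) :=
    ((b₁.prod b₂).map (Submodule.prodEquivOfIsCompl W₁ W₂' hcompl)).reindex e
  have hbV_inl : ∀ i : Fin r, bV (e (Sum.inl i)) = (b₁ i : Fin d → k) := by
    intro i
    simp only [bV, Module.Basis.reindex_apply, Equiv.symm_apply_apply, Module.Basis.map_apply,
      Submodule.coe_prodEquivOfIsCompl', Module.Basis.prod_apply, Sum.elim_inl, LinearMap.coe_inl,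
      Submodule.coe_zero, add_zero, Function.comp_apply]
  have he_inl : ∀ i : Fin r, e (Sum.inl i) = Fin.castLE hrd i := by
    intro i
    apply Fin.ext
    simp [e, finSumFinEquiv_apply_left]
  have he_inr : ∀ j : Fin (d - r), (e (Sum.inr j)).val = r + j.val := by
    intro j
    simp [e, finSumFinEquiv_apply_right]
  -- coordinates of vectors of `W₁` / `W₂'`
  have hrepr₁ : ∀ v ∈ W₁, ∀ j : Fin (d - r), bV.repr v (e (Sum.inr j)) = 0 := by
    intro v hv j
    have hsymm : (Submodule.prodEquivOfIsCompl W₁ W₂' hcompl).symm v = ((⟨v, hv⟩ : W₁), 0) :=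
      Submodule.prodEquivOfIsCompl_symm_apply_left W₁ W₂' hcompl (⟨v, hv⟩ : W₁)
    simp only [bV, Module.Basis.repr_reindex, Finsupp.mapDomain_equiv_apply, Equiv.symm_apply_apply,
      Module.Basis.map_repr, LinearEquiv.trans_apply, hsymm, Module.Basis.prod_repr_inr, map_zero,
      Finsupp.coe_zero, Pi.zero_apply]
  have hrepr₂ : ∀ v ∈ W₂', ∀ j : Fin r, bV.repr v (e (Sum.inl j)) = 0 := by
    intro v hv j
    have hsymm : (Submodule.prodEquivOfIsCompl W₁ W₂' hcompl).symm v = (0, (⟨v, hv⟩ : W₂')) :=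
      Submodule.prodEquivOfIsCompl_symm_apply_right W₁ W₂' hcompl (⟨v, hv⟩ : W₂')
    simp only [bV, Module.Basis.repr_reindex, Finsupp.mapDomain_equiv_apply, Equiv.symm_apply_apply,
      Module.Basis.map_repr, LinearEquiv.trans_apply, hsymm, Module.Basis.prod_repr_inl, map_zero,
      Finsupp.coe_zero, Pi.zero_apply]
  -- the matrix of rows `bV`
  have hdet : IsUnit (Matrix.det (fun i j => bV i j : Matrix (Fin d) (Fin d) k)) :=
    isUnit_det_of_linearIndependent_rows bV.linearIndependent
  refine ⟨fun i j => bV i j, hrd, hdet, ?_, ?_, ?_⟩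
  · intro i
    rw [← he_inl]
    exact hbV_inl i
  · intro v hv i hi
    rw [vecMul_inv_eq_repr bV (fun i => rfl) hdet v]
    obtain ⟨j, rfl⟩ : ∃ j : Fin (d - r), i = e (Sum.inr j) := by
      refine ⟨⟨i.val - r, by omega⟩, Fin.ext ?_⟩
      rw [he_inr]
      simp only
      omega
    exact hrepr₁ v hv j
  · intro v hv i hi
    rw [vecMul_inv_eq_repr bV (fun i => rfl) hdet v]
    obtain ⟨j, rfl⟩ : ∃ j : Fin r, i = e (Sum.inl j) := ⟨⟨i.val, hi⟩, by rw [he_inl]; rfl⟩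
    exact hrepr₂ v (hW₂le hv) j

/-- COORDINATES FOR A LINEARLY INDEPENDENT FAMILY: an invertible `Q` in whose coordinates the vectors `a j`, `j ∈ s`, are distinct
standard basis vectors. [folklore] -/
theorem exists_matrix_of_linearIndependent {a : ι → Fin d → k} {s : Finset ι}
    (hli : LinearIndependent k (fun j : ↥s => a j)) :
    ∃ (Q : Matrix (Fin d) (Fin d) k) (σ : ↥s → Fin d), IsUnit Q.det ∧ Function.Injective σ ∧
      ∀ j : ↥s, a j ᵥ* Q⁻¹ = Pi.single (σ j) (1 : k) := by
  classical
  let bS : Module.Basis (↥s) k (span k (Set.range fun j : ↥s => a j)) := Module.Basis.span hli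
  let eS : ↥s ≃ Fin s.card := Fintype.equivFinOfCardEq (Fintype.card_coe s)
  let b₁ : Module.Basis (Fin s.card) k (span k (Set.range fun j : ↥s => a j)) := bS.reindex eS
  obtain ⟨Q, hr, hdet, hrows, -, -⟩ :=
    exists_adapted_matrix (span k (Set.range fun j : ↥s => a j)) ⊥ disjoint_bot_right b₁
  refine ⟨Q, fun j => Fin.castLE hr (eS j), hdet, ?_, ?_⟩
  · intro j j' h
    exact eS.injective (Fin.castLE_injective hr h)
  · intro j
    rw [← row_vecMul_inv hdet, hrows (eS j)]
    congr 1
    simp [b₁, bS, Module.Basis.span_apply]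

end NCArrangement

end Summit.ResolutionOfSingularities.ResolutionOfSingularities.Theorems
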